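import Summits.BirchSwinnertonDyer.Rank1Residual.F1Sign2.WildPacketAtTwo
import Literature.NumberTheory.EllipticCurves.SelmerTorsionTwistRestriction
import Literature.NumberTheory.EllipticCurves.Kato2004.Condition1252QuadraticTwistProofs
import HarnessLib

/-!
# Cell `bsd-f1-sign2`, AN-32 support: AN-32M `TwistSelmerModelInvarianceAtTwo` and AN-32i `TwinImageContainsSL2AtTwo` ARE THEOREMS — `twistSelmerModelInvarianceAtTwo_holds`, `twinImageContainsSL2AtTwo_holds`

PROOF FILE (seat `-ty` g10, «discharge when cheap»; statement file `F1Sign2/WildPacketAtTwo.lean` p638887 = -an g15 Sketch_v23 §0–§4,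
REF1 §111).  THEOREMS ONLY (no `def`, no `sorry`, standard axioms).  AN-32M says that -desc's raw-model count
`twistSelmerTwoCard W 2 = Nat.card Sel₂(W.quadraticTwist 2)` equals `selmerTwoCard W₂ = Nat.card Sel₂(W₂)` for every model `W₂` with
`C • W.quadraticTwist 2 = W₂`: this is the tree theorem `Literature.NumberTheory.EllipticCurves.natCard_selmerGroup_eq_of_variableChange`
(isomorphic curves over a number field have `n`-Selmer groups of the same order, place by place; Silverman AEC X.§4) at `n = 2`, `K = ℚ`.
Consequence by name: the U-bottom rung `UBottomOnPrimitiveLocusAtTwo` now needs only AN-32U + AN-32K + AN-32i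
(`uBottomOnPrimitiveLocus_of_three`).  REF1 §111 r3 (finiteness of `Sel₂`, tree `WeierstrassCurve.finite_selmerGroup_holds`) is not needed for the
equality of cardinalities.  PARTITION: none moved; beyond-print theorem: no.  BSD is not proved by any of this.  [cite: SilvermanAEC2009, X.§4]
-/

set_option autoImplicit false

noncomputable section

open scoped Classical

namespace Summit.BirchSwinnertonDyer.Rank1Residual.F1Sign2.WildPacket

open Literature.NumberTheory.EllipticCurves Literature.NumberTheory.EllipticCurves.Rank1Residual

/-- **AN-32M is a theorem**: `#Sel₂` of the raw twist model equals `#Sel₂` of any isomorphic (e.g. globally minimal) model. -/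
theorem twistSelmerModelInvarianceAtTwo_holds : TwistSelmerModelInvarianceAtTwo := by
  intro W _ W₂ _ _ C hC
  unfold twistSelmerTwoCard selmerTwoCard
  have hC' : C • W.quadraticTwist (((2 : ℤ) : ℚ)) = W₂ := by simpa using hC
  exact natCard_selmerGroup_eq_of_variableChange 2 hC'

/-- By name: the U-bottom rung from three hypotheses (AN-32M discharged). -/
theorem uBottomOnPrimitiveLocus_of_three (hU : ShaTwoReadByWildTwinAtTwo) (hK : AdditiveUnitValueKillsSelmerTwoAtTwo)
    (hI : TwinImageContainsSL2AtTwo) : UBottomOnPrimitiveLocusAtTwo :=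
  uBottomOnPrimitiveLocus_of hU hK twistSelmerModelInvarianceAtTwo_holds hI

example : TwistSelmerModelInvarianceAtTwo := twistSelmerModelInvarianceAtTwo_holds

/-! ### AN-32i `TwinImageContainsSL2AtTwo` is a theorem

Kato's (12.5.2) only concerns `Gal(ℚ̄/ℚ(ζ_{2^∞}))`, and `√2 = ζ₈ + ζ₈⁻¹ ∈ ℚ(ζ₈)`; so `T_2E` and `T_2E^{(2)}` are isomorphic as
`Gal(ℚ̄/ℚ(ζ_{2^∞}))`-modules (Silverman X.5.4) and (12.5.2) transfers — verbatim the tree's argument for the twist by `p*` at odd `p`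
(`Kato2004.imageContainsSL2_iff_of_smul_eq_quadraticTwist_primeStar`, Gauss sum), with the Gauss sum replaced by `ζ₈ + ζ₈⁷`. -/

open WeierstrassCurve Literature.NumberTheory.EllipticCurves.Kato2004 in
/-- `σ(√2) = √2` for every `σ ∈ Γ_ℚ` fixing all `2`-power roots of unity: `(ζ₈ + ζ₈⁷)² = 2`. -/
theorem smul_geomSqrt_two_eq (σ : Field.absoluteGaloisGroup ℚ)
    (hσ : ∀ (n : ℕ) (t : AlgebraicClosure ℚ), t ^ 2 ^ n = 1 → σ • t = t) :
    σ • geomSqrt (2 : ℚ) = geomSqrt (2 : ℚ) := by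
  obtain ⟨ζ, hζ⟩ := HasEnoughRootsOfUnity.exists_primitiveRoot (AlgebraicClosure ℚ) 8
  have h8 : ζ ^ 8 = 1 := hζ.pow_eq_one
  have h4 : ζ ^ 4 = -1 := by
    have hne : ζ ^ 4 ≠ 1 := hζ.pow_ne_one_of_pos_of_lt (by norm_num) (by norm_num)
    have hsq : (ζ ^ 4) ^ 2 = 1 := by rw [← pow_mul]; exact h8
    have hsq' : ζ ^ 4 * ζ ^ 4 = 1 := by rw [← pow_two]; exact hsq
    rcases mul_self_eq_one_iff.mp hsq' with h | h
    · exact absurd h hne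
    · exact h
  set g : AlgebraicClosure ℚ := ζ + ζ ^ 7 with hg
  have hg2 : g ^ 2 = algebraMap ℚ (AlgebraicClosure ℚ) 2 := by
    rw [map_ofNat, hg]
    linear_combination (2 : AlgebraicClosure ℚ) * h8 + ζ ^ 2 * (ζ ^ 8 - ζ ^ 4 + 1) * h4
  have hσζ : Field.absoluteGaloisGroup.toAlgEquiv ℚ σ ζ = ζ := by
    have := hσ 3 ζ (by norm_num [h8])
    rwa [Field.absoluteGaloisGroup.smul_def] at this
  have hσg : Field.absoluteGaloisGroup.toAlgEquiv ℚ σ g = g := by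
    rw [hg, map_add, map_pow, hσζ]
  have hsq : geomSqrt (2 : ℚ) ^ 2 = g ^ 2 := (geomSqrt_sq _).trans hg2.symm
  rcases sq_eq_sq_iff_eq_or_eq_neg.mp hsq with h | h
  · rw [Field.absoluteGaloisGroup.smul_def, h, hσg]
  · rw [Field.absoluteGaloisGroup.smul_def, h, map_neg, hσg]

open WeierstrassCurve Literature.NumberTheory.EllipticCurves.Kato2004 in
/-- **(12.5.2) at `p = 2` is invariant under the quadratic twist by `2`** (`C • W.quadraticTwist 2 = V`). -/
theorem imageContainsSL2_two_iff_of_smul_eq_quadraticTwist_two {V W : WeierstrassCurve ℚ} (C : VariableChange ℚ)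
    (hWV : C • W.quadraticTwist (2 : ℚ) = V) :
    ImageContainsSL2 V 2 ↔ ImageContainsSL2 W 2 := by
  subst hWV
  have hd0 : (2 : ℚ) ≠ 0 := two_ne_zero
  obtain ⟨f, hf⟩ := exists_addEquiv_geomPoints_quadraticTwist W hd0
  let e : (W.quadraticTwist 2).geomPoints ≃+ (C • W.quadraticTwist 2).geomPoints :=
    VariableChange.pointEquivBaseChange (W.quadraticTwist 2) C (AlgebraicClosure ℚ)
  have he : ∀ (σ : Field.absoluteGaloisGroup ℚ) (P : (W.quadraticTwist 2).geomPoints),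
      e (σ • P) = σ • e P := fun σ P ↦
    VariableChange.pointEquivBaseChange_map_algEquiv (W.quadraticTwist 2) C
      (Field.absoluteGaloisGroup.toAlgEquiv ℚ σ) P
  let F : (C • W.quadraticTwist 2).geomPoints ≃+ W.geomPoints := e.symm.trans f
  have hF : ∀ σ ∈ {σ : Field.absoluteGaloisGroup ℚ | ∀ (n : ℕ) (t : AlgebraicClosure ℚ),
        t ^ 2 ^ n = 1 → σ • t = t}, ∀ P, F (σ • P) = σ • F P := by
    intro σ hσ P
    have hfix : σ • geomSqrt (2 : ℚ) = geomSqrt (2 : ℚ) := smul_geomSqrt_two_eq σ hσ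
    change f (e.symm (σ • P)) = σ • f (e.symm P)
    have h1 : e.symm (σ • P) = σ • e.symm P := by
      apply e.injective
      rw [AddEquiv.apply_symm_apply, he, AddEquiv.apply_symm_apply]
    rw [h1, hf σ hfix]
  have hFs : ∀ σ ∈ {σ : Field.absoluteGaloisGroup ℚ | ∀ (n : ℕ) (t : AlgebraicClosure ℚ),
        t ^ 2 ^ n = 1 → σ • t = t}, ∀ Q, F.symm (σ • Q) = σ • F.symm Q := by
    intro σ hσ Q
    apply F.injective
    rw [AddEquiv.apply_symm_apply, hF σ hσ, AddEquiv.apply_symm_apply]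
  obtain ⟨L, hL⟩ := exists_tateModule_linearEquiv_of_addEquiv _ _ 2 _ F hF
  obtain ⟨L', hL'⟩ := exists_tateModule_linearEquiv_of_addEquiv _ _ 2 _ F.symm hFs
  exact ⟨fun h ↦ imageContainsSL2_of_tateModule_linearEquiv L (fun σ hσ ↦ hL σ hσ) h,
    fun h ↦ imageContainsSL2_of_tateModule_linearEquiv L' (fun σ hσ ↦ hL' σ hσ) h⟩

/-- **AN-32i is a theorem**: `ρ_{E,2^∞}` onto ⟹ Kato's (12.5.2) at `2` for the twist `E^{(2)}` (any model `W₂` of it). -/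
theorem twinImageContainsSL2AtTwo_holds : TwinImageContainsSL2AtTwo := by
  intro W _ W₂ _ _ C hC hsurj
  have hW : Literature.NumberTheory.EllipticCurves.Kato2004.ImageContainsSL2 W 2 :=
    Literature.NumberTheory.EllipticCurves.Kato2004.imageContainsSL2_of_forall_hasSurjectiveModNGaloisRep W 2 hsurj
  exact (imageContainsSL2_two_iff_of_smul_eq_quadraticTwist_two C hC).mpr hW

/-- By name: the U-bottom rung from the two substantive hypotheses only (AN-32M and AN-32i discharged). -/
theorem uBottomOnPrimitiveLocus_of_two (hU : ShaTwoReadByWildTwinAtTwo) (hK : AdditiveUnitValueKillsSelmerTwoAtTwo) :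
    UBottomOnPrimitiveLocusAtTwo :=
  uBottomOnPrimitiveLocus_of hU hK twistSelmerModelInvarianceAtTwo_holds twinImageContainsSL2AtTwo_holds

example : TwinImageContainsSL2AtTwo := twinImageContainsSL2AtTwo_holds

end Summit.BirchSwinnertonDyer.Rank1Residual.F1Sign2.WildPacket

end
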